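import Literature.Analysis.FluidPDE.TaoWeightedEulerForm
import Literature.Analysis.FluidPDE.TaoAveragedSingleScaleAt
import HarnessLib

/-!
# Tao 2016, §3.3–§3.4 with the base triple as a parameter: `ρ_ξ`, `B_{η,ρ;ξ}`, `B_{η,ρ,n;ξ}` and
# their weights, the scaling law

T. Tao, *Finite time blowup for an averaged three-dimensional Navier–Stokes equation*,
J. Amer. Math. Soc. **29** (2016), 601–674 = arXiv:1402.0290v3, §3.3–§3.4 pp. 16–17. DEFINITIONS
file, sequel of `TaoAveragedSingleScaleAt.lean` (which records `etaAt ξ ε₀` and the single-scale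
target `betaRhoZeroFormAt ξ ε₀` = `B_{η,ρ,0}` of (3.9) about an ARBITRARY base triple `ξ`) and of
`TaoWeightedEulerForm.lean` (the shape `weightedForm W` and the scaling law `weightedForm_dil`).
HONEST FRAMING (cell harvest/h2-tao-ladder, TAO-LADDER rung M_1 — MODEL statements about Tao's
averaged equation): the printed objects of §3.3–§3.4 with `ξ⁰ = xi0` replaced by a parameter `ξ`,
for the rung-1 support item `CascadeNoDilOfSingleScaleAt` (§3.3–§3.4 at a general closed base
triple); nothing here concerns the true Navier–Stokes equations, and nothing is asserted beyond
definitional identities and the scaling law.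

* `rhoAt ξ ε₀` — `ρ_ξ(ζ) = Σ_{n ∈ ℤ} φ(|(1+ε₀)^{-n}ζ - ξ 0|/ε₀²)` (Tao's `ρ` with `ξ₁⁰ ↦ ξ 0`);
* `scaleWeightAt ξ ε₀ n`, `rhoWeightAt ξ ε₀` — the weights `φ(|(1+ε₀)^{-n}ζ₁ - ξ 0|/ε₀²) η_ξ` of
  `B_{η,ρ,n;ξ}` and `ρ_ξ η_ξ` of `B_{η,ρ;ξ}` (`η_ξ = etaAt ξ ε₀`);
* `betaRhoScaleFormAt ξ ε₀ n`, `betaRhoFormAt ξ ε₀` — `B_{η,ρ,n;ξ}` (prefactor `(1+ε₀)^{-5n/2}`) and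
  `B_{η,ρ;ξ} = -πi ∫ ρ_ξ η_ξ Λ`;
* consistency: `…_xi0` lemmas (the tree's `rho`, `scaleWeight`, `rhoWeight`, `betaRhoScaleForm`,
  `betaRhoForm` are the `xi0` instances), `betaRhoZeroFormAt_eq_weightedForm`,
  `betaRhoScaleFormAt_zero`, `rhoWeightAt_eq_tsum`;
* the scaling law of §3.4 about `ξ`: `etaAt_mul_left` (scale invariance of `η_ξ`),
  `scaleWeightAt_zero_smul`, **`betaRhoScaleFormAt_eq_dil`**:
  `⟨B_{η,ρ,n;ξ}(u,v), w⟩ = ⟨B_{η,ρ,0;ξ}(Dil u, Dil v), Dil w⟩`, `Dil = Dil_{(1+ε₀)^{-n}}`.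

## References

* T. Tao, J. Amer. Math. Soc. 29 (2016), 601–674, arXiv:1402.0290v3, §3.3 p. 16, §3.4 pp. 16–17
  ((3.8), (3.9)), Remark 3.5 p. 20. Key `Tao2016AveragedNS`.
-/

noncomputable section

open MeasureTheory Set Filter FourierTransform
open scoped ENNReal NNReal SchwartzMap

namespace Literature.Analysis.FluidPDE.Tao2016

/-- Local notation for physical / frequency space `ℝ³`. -/
local notation "ℝ³" => EuclideanSpace ℝ (Fin 3)

/-! ### The objects of §3.3–§3.4 about a base triple `ξ` -/

/-- **The scale-localising symbol `ρ` about `ξ`**: `ρ_ξ(ζ) = Σ_{n ∈ ℤ} φ(|(1+ε₀)^{-n}ζ - ξ 0|/ε₀²)`,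
supported on the union of the balls `(1+ε₀)ⁿ · B(ξ 0, 2ε₀²)` (Tao's `ρ` is the `xi0` instance,
`rhoAt_xi0`). `tsum` junk `0` where not summable. [cite: Tao2016AveragedNS, §3.3 p. 16] -/
def rhoAt (ξ : Fin 3 → ℝ³) (ε₀ : ℝ) (ζ : ℝ³) : ℝ :=
  ∑' n : ℤ, freqCutoff (‖((1 + ε₀) ^ (-n) : ℝ) • ζ - ξ 0‖ / ε₀ ^ 2)

/-- **The weight of `B_{η,ρ,n;ξ}`**: `φ(|(1+ε₀)^{-n}ζ₁ - ξ 0|/ε₀²) η_ξ(|ζ₁|,|ζ₂|,|ζ₃|)`.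
[cite: Tao2016AveragedNS, §3.4 p. 16] -/
def scaleWeightAt (ξ : Fin 3 → ℝ³) (ε₀ : ℝ) (n : ℤ) (p : ℝ³ × ℝ³) : ℝ :=
  freqCutoff (‖((1 + ε₀) ^ (-n) : ℝ) • p.1 - ξ 0‖ / ε₀ ^ 2) * etaAt ξ ε₀ ‖p.1‖ ‖p.2‖ ‖-p.1 - p.2‖

/-- **The weight of `B_{η,ρ;ξ}`**: `ρ_ξ(ζ₁) η_ξ(|ζ₁|,|ζ₂|,|ζ₃|)`. [cite: Tao2016AveragedNS, §3.3 p. 16] -/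
def rhoWeightAt (ξ : Fin 3 → ℝ³) (ε₀ : ℝ) (p : ℝ³ × ℝ³) : ℝ :=
  rhoAt ξ ε₀ p.1 * etaAt ξ ε₀ ‖p.1‖ ‖p.2‖ ‖-p.1 - p.2‖

/-- **`B_{η,ρ,n;ξ}`** (§3.4 with `ξ⁰ ↦ ξ`):
`⟨B_{η,ρ,n;ξ}(u,v), w⟩ = (1+ε₀)^{-5n/2} ∫_{ζ₁+ζ₂+ζ₃=0} φ(|(1+ε₀)^{-n}ζ₁ - ξ 0|/ε₀²) η_ξ Λ(û(ζ₁), v̂(ζ₂), ŵ(ζ₃))`.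
[cite: Tao2016AveragedNS, §3.4 p. 16] -/
def betaRhoScaleFormAt (ξ : Fin 3 → ℝ³) (ε₀ : ℝ) (n : ℤ) (u v w : L2C) : ℂ :=
  (((1 + ε₀) ^ (-(5 : ℝ) * (n : ℝ) / 2) : ℝ) : ℂ) * weightedForm (scaleWeightAt ξ ε₀ n) u v w

/-- **`B_{η,ρ;ξ}` by its symbol**: `⟨B_{η,ρ;ξ}(u,v), w⟩ = -πi ∫ ρ_ξ(ζ₁) η_ξ(|ζ₁|,|ζ₂|,|ζ₃|) Λ(û(ζ₁), v̂(ζ₂), ŵ(ζ₃))`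
(`B_{η,ρ}(u,v) = B_η(ρ(D)u, v)`, §3.3, last paragraph). [cite: Tao2016AveragedNS, §3.3 p. 16] -/
def betaRhoFormAt (ξ : Fin 3 → ℝ³) (ε₀ : ℝ) (u v w : L2C) : ℂ :=
  -(Real.pi * Complex.I) * weightedForm (rhoWeightAt ξ ε₀) u v w

/-! ### Consistency with the tree at `xi0`, and unfoldings -/

/-- `ρ_{xi0}` is Tao's `ρ`. [cite: Tao2016AveragedNS, §3.3 p. 16] -/
theorem rhoAt_xi0 (ε₀ : ℝ) : rhoAt xi0 ε₀ = rho ε₀ := rfl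

/-- The weights of `B_{η,ρ,n;xi0}` are the tree's `scaleWeight`. [cite: Tao2016AveragedNS, §3.4 p. 16] -/
theorem scaleWeightAt_xi0 (ε₀ : ℝ) (n : ℤ) : scaleWeightAt xi0 ε₀ n = scaleWeight ε₀ n := rfl

/-- The weight of `B_{η,ρ;xi0}` is the tree's `rhoWeight`. [cite: Tao2016AveragedNS, §3.3 p. 16] -/
theorem rhoWeightAt_xi0 (ε₀ : ℝ) : rhoWeightAt xi0 ε₀ = rhoWeight ε₀ := rfl

/-- `B_{η,ρ,n;xi0}` is the tree's `B_{η,ρ,n}`. [cite: Tao2016AveragedNS, §3.4 p. 16] -/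
theorem betaRhoScaleFormAt_xi0 (ε₀ : ℝ) (n : ℤ) : betaRhoScaleFormAt xi0 ε₀ n = betaRhoScaleForm ε₀ n := by
  funext u v w
  rw [betaRhoScaleForm_eq_weightedForm]
  rfl

/-- `B_{η,ρ;xi0}` is the tree's `B_{η,ρ}`. [cite: Tao2016AveragedNS, §3.3 p. 16] -/
theorem betaRhoFormAt_xi0 (ε₀ : ℝ) : betaRhoFormAt xi0 ε₀ = betaRhoForm ε₀ := by
  funext u v w
  rw [betaRhoForm_eq_weightedForm]
  rfl

/-- **`B_{η,ρ,0;ξ}` (the tree's `betaRhoZeroFormAt`) is the `scaleWeightAt ξ ε₀ 0`-form.**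
[cite: Tao2016AveragedNS, §3.4 (3.9)] -/
theorem betaRhoZeroFormAt_eq_weightedForm (ξ : Fin 3 → ℝ³) (ε₀ : ℝ) (U V X : L2C) :
    betaRhoZeroFormAt ξ ε₀ U V X = weightedForm (scaleWeightAt ξ ε₀ 0) U V X := by
  unfold betaRhoZeroFormAt weightedForm scaleWeightAt eulerIntegrand
  simp

/-- `B_{η,ρ,0;ξ}` is the `n = 0` single-scale form. [cite: Tao2016AveragedNS, §3.4 (3.9)] -/
theorem betaRhoScaleFormAt_zero (ξ : Fin 3 → ℝ³) (ε₀ : ℝ) :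
    betaRhoScaleFormAt ξ ε₀ 0 = betaRhoZeroFormAt ξ ε₀ := by
  funext U V X
  rw [betaRhoZeroFormAt_eq_weightedForm, betaRhoScaleFormAt]
  simp

/-- `B_{η,ρ,n;ξ} = (1+ε₀)^{-5n/2} × (scaleWeightAt-form)` (by `rfl`). [cite: Tao2016AveragedNS, §3.4 p. 16] -/
theorem betaRhoScaleFormAt_eq_weightedForm (ξ : Fin 3 → ℝ³) (ε₀ : ℝ) (n : ℤ) (U V X : L2C) :
    betaRhoScaleFormAt ξ ε₀ n U V X =
      (((1 + ε₀) ^ (-(5 : ℝ) * (n : ℝ) / 2) : ℝ) : ℂ) * weightedForm (scaleWeightAt ξ ε₀ n) U V X :=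
  rfl

/-- `B_{η,ρ;ξ} = -πi × (rhoWeightAt-form)` (by `rfl`). [cite: Tao2016AveragedNS, §3.3 p. 16] -/
theorem betaRhoFormAt_eq_weightedForm (ξ : Fin 3 → ℝ³) (ε₀ : ℝ) (U V X : L2C) :
    betaRhoFormAt ξ ε₀ U V X = -(Real.pi * Complex.I) * weightedForm (rhoWeightAt ξ ε₀) U V X :=
  rfl

/-- `B_{η,ρ;ξ}` written out as a symbol integral. [cite: Tao2016AveragedNS, §3.3 p. 16] -/
theorem betaRhoFormAt_eq_integral (ξ : Fin 3 → ℝ³) (ε₀ : ℝ) (u v w : L2C) :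
    betaRhoFormAt ξ ε₀ u v w = -(Real.pi * Complex.I) *
      ∫ p : ℝ³ × ℝ³, ((rhoAt ξ ε₀ p.1 * etaAt ξ ε₀ ‖p.1‖ ‖p.2‖ ‖-p.1 - p.2‖ : ℝ) : ℂ) *
        Λ p.1 p.2 (fourierFn u p.1) (fourierFn v p.2) (fourierFn w (-p.1 - p.2)) := rfl

/-- `ρ_ξ η_ξ = Σₙ (scale weights)`, pointwise. [cite: Tao2016AveragedNS, §3.3–3.4 p. 16] -/
theorem rhoWeightAt_eq_tsum (ξ : Fin 3 → ℝ³) (ε₀ : ℝ) (p : ℝ³ × ℝ³) :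
    rhoWeightAt ξ ε₀ p = ∑' n : ℤ, scaleWeightAt ξ ε₀ n p := by
  unfold rhoWeightAt rhoAt scaleWeightAt
  rw [tsum_mul_right]

/-! ### The scaling law of §3.4 about `ξ` -/

/-- `η_ξ` is scale invariant: `η_ξ(cN₁, cN₂, cN₃) = η_ξ(N₁, N₂, N₃)` (`c ≠ 0`). [cite: Tao2016AveragedNS, §3.3 p. 16] -/
theorem etaAt_mul_left (ξ : Fin 3 → ℝ³) (ε₀ : ℝ) {c : ℝ} (hc : c ≠ 0) (N₁ N₂ N₃ : ℝ) :
    etaAt ξ ε₀ (c * N₁) (c * N₂) (c * N₃) = etaAt ξ ε₀ N₁ N₂ N₃ := by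
  unfold etaAt
  rw [mul_div_mul_left _ _ hc, mul_div_mul_left _ _ hc]

/-- The weight of `B_{η,ρ,0;ξ}` rescaled by `(1+ε₀)^{-n}` is the weight of `B_{η,ρ,n;ξ}`.
[cite: Tao2016AveragedNS, §3.4 p. 16] -/
theorem scaleWeightAt_zero_smul (ξ : Fin 3 → ℝ³) {ε₀ : ℝ} (hε : 0 < 1 + ε₀) (n : ℤ) (p : ℝ³ × ℝ³) :
    scaleWeightAt ξ ε₀ 0 (((1 + ε₀) ^ n)⁻¹ • p) = scaleWeightAt ξ ε₀ n p := by
  have hc : 0 < ((1 + ε₀) ^ n)⁻¹ := inv_pos.2 (zpow_pos hε n)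
  unfold scaleWeightAt
  simp only [Prod.smul_fst, Prod.smul_snd, neg_zero, zpow_zero, one_smul]
  rw [show -(((1 + ε₀) ^ n)⁻¹ • p.1) - ((1 + ε₀) ^ n)⁻¹ • p.2 = ((1 + ε₀) ^ n)⁻¹ • (-p.1 - p.2) by
      rw [smul_sub, smul_neg], norm_smul, norm_smul, norm_smul, Real.norm_of_nonneg hc.le,
    etaAt_mul_left ξ ε₀ hc.ne', zpow_neg]

/-- **The scaling law `⟨B_{η,ρ,n;ξ}(u,v), w⟩ = ⟨B_{η,ρ,0;ξ}(Dil u, Dil v), Dil w⟩`,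
`Dil = Dil_{(1+ε₀)^{-n}}`** (§3.4, first display after (3.8), with `ξ⁰ ↦ ξ`), for all
`u, v, w ∈ L²`. [cite: Tao2016AveragedNS, §3.4 p. 16] -/
theorem betaRhoScaleFormAt_eq_dil (ξ : Fin 3 → ℝ³) {ε₀ : ℝ} (hε : 0 < 1 + ε₀) (n : ℤ) (U V X : L2C) :
    betaRhoScaleFormAt ξ ε₀ n U V X =
      betaRhoZeroFormAt ξ ε₀ (dil ((1 + ε₀) ^ n)⁻¹ U) (dil ((1 + ε₀) ^ n)⁻¹ V)
        (dil ((1 + ε₀) ^ n)⁻¹ X) := by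
  have hc : 0 < ((1 + ε₀) ^ n)⁻¹ := inv_pos.2 (zpow_pos hε n)
  rw [betaRhoZeroFormAt_eq_weightedForm, weightedForm_dil _ hc, betaRhoScaleFormAt_eq_weightedForm,
    scale_prefactor_eq hε]
  congr 1
  unfold weightedForm
  simp_rw [scaleWeightAt_zero_smul ξ hε n]

/-- `B_{η,ρ;ξ}` is homogeneous in its first field. [cite: Tao2016AveragedNS, §3.3 p. 16] -/
theorem betaRhoFormAt_smul₁ (ξ : Fin 3 → ℝ³) (ε₀ : ℝ) (a : ℂ) (U V X : L2C) :
    betaRhoFormAt ξ ε₀ (a • U) V X = a * betaRhoFormAt ξ ε₀ U V X := by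
  rw [betaRhoFormAt_eq_weightedForm, betaRhoFormAt_eq_weightedForm, weightedForm_smul₁]
  ring

end Literature.Analysis.FluidPDE.Tao2016
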